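import Literature.NumberTheory.LFunctions.VTypicalOrdinates
import Literature.NumberTheory.LFunctions.ZetaZerosDeviationFrequency
import Literature.NumberTheory.LFunctions.PrimeDirichletPolynomialMomentsStrip
import HarnessLib

/-!
# The number of well-spaced `V`-atypical ordinates (Balazard–de Roton 2008, Prop. 20)

Topic `Literature/NumberTheory/LFunctions`. Everything in this file is PROVED (no definitions, no
named facts).

M. Balazard, A. de Roton, arXiv:0810.3587, Prop. 20 (= K. Soundararajan 2009, Prop. 4, second
assertion; used in arXiv:0812.1689 §6 through the contour construction):

> **Proposition 20 (RH).** `T` grand, `2(log log T)² ≤ V ≤ log T/log log T`, `T ≤ t_1 < ⋯ < t_R ≤ 2T`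
> des ordonnées `V`-atypiques avec `t_{r+1} − t_r ≥ 1`. Alors
> `R ≪ T exp(−V log(V/log log T) + 2V log log V + O(V))`.

`Literature.NumberTheory.LFunctions.card_atypical_le_of_RH`: under RH, for `0 < δ ≤ 1` there is
`T₀ = T₀(δ)` such that for `T ≥ T₀`, `2(log log T)² ≤ V ≤ log T/log log T` and every finite `1`-spaced
`𝒯 ⊂ [T, 2T]` of ordinates that are not `V`-typical of size `T` (`IsVTypical δ T V`),
`#𝒯 ≤ T exp(−V log(V/log log T) + 2V log log V + 12V)`.

Proof (as printed): an atypical ordinate violates (i), (ii) or (iii). For (i), the proper prime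
powers contribute `O(log log T)`, the real part `σ` is `< 1` (else the sum is `O(log log T)`), and
the moments of the prime Dirichlet polynomial at the points `σ_r + it_r`
(`sum_norm_primePoly_pow_le_strip`, Prop. 13) with `k = ⌊V⌋` bound the count. For (ii) and (iii) a
violating window centred at `t'_r`, `|t'_r − t_r| ≤ 1`, is a large deviation of the zero count;
splitting the `t_r` into four classes according to `⌊t_r⌋ mod 4` makes the `t'_r` well spaced
(`AtypicalCount.card_le_four_mul_of_shift`), and Prop. 17 (`card_deviations_le_of_RH`) applies.

## References

* [BalazardDeRoton2008] M. Balazard, A. de Roton, arXiv:0810.3587, Prop. 20. [cite: BalazardDeRoton2008, Prop. 20]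
* K. Soundararajan, J. reine angew. Math. 631 (2009), Prop. 4.
-/

noncomputable section

open Complex Filter Set Topology Finset ArithmeticFunction
open scoped Real

namespace Literature.NumberTheory.LFunctions

open ChebyshevWeighted VTypical

namespace AtypicalCount

/-! ## Well-spacing of shifted ordinates: the four classes `⌊t⌋ mod 4` -/

/-- Two `1`-spaced nonnegative reals with `⌊t⌋ ≡ ⌊t'⌋ (mod 4)` are more than `3` apart. [folklore] -/
theorem three_lt_abs_sub_of_floor_mod_eq {t t' : ℝ} (ht : 0 ≤ t) (ht' : 0 ≤ t')
    (hsep : 1 ≤ |t - t'|) (hmod : ⌊t⌋₊ % 4 = ⌊t'⌋₊ % 4) : 3 < |t - t'| := by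
  have h1 := Nat.floor_le ht
  have h2 := Nat.lt_floor_add_one t
  have h1' := Nat.floor_le ht'
  have h2' := Nat.lt_floor_add_one t'
  rcases Nat.lt_trichotomy ⌊t⌋₊ ⌊t'⌋₊ with hlt | heq | hgt
  · -- `⌊t'⌋ ≥ ⌊t⌋ + 4`
    have hdvd : 4 ∣ ⌊t'⌋₊ - ⌊t⌋₊ := (Nat.modEq_iff_dvd' hlt.le).1 hmod
    obtain ⟨m, hm⟩ := hdvd
    have hm1 : 1 ≤ m := by
      rcases Nat.eq_zero_or_pos m with rfl | h
      · omega
      · exact h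
    have h4 : ⌊t⌋₊ + 4 ≤ ⌊t'⌋₊ := by omega
    have h4r : (⌊t⌋₊ : ℝ) + 4 ≤ ⌊t'⌋₊ := by exact_mod_cast h4
    rw [abs_sub_comm, abs_of_pos (by linarith)]
    linarith
  · exfalso
    have : |t - t'| < 1 := by
      rw [heq] at h1 h2
      rw [abs_lt]; constructor <;> linarith
    linarith
  · have hdvd : 4 ∣ ⌊t⌋₊ - ⌊t'⌋₊ := (Nat.modEq_iff_dvd' hgt.le).1 hmod.symm
    obtain ⟨m, hm⟩ := hdvd
    have hm1 : 1 ≤ m := by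
      rcases Nat.eq_zero_or_pos m with rfl | h
      · omega
      · exact h
    have h4 : ⌊t'⌋₊ + 4 ≤ ⌊t⌋₊ := by omega
    have h4r : (⌊t'⌋₊ : ℝ) + 4 ≤ ⌊t⌋₊ := by exact_mod_cast h4
    rw [abs_of_pos (by linarith)]
    linarith

/-- **The four-classes trick.** Let `𝒯 ⊂ [T, 2T]` (`T ≥ 0`) be finite and `1`-spaced and
`φ` a map with `|φ(t) − t| ≤ 1` on `𝒯`. If every finite `1`-spaced `𝒯' ⊂ [T−1, 2T+1]` contained
in `φ(𝒯)` has at most `M` elements, then `#𝒯 ≤ 4M`. [cite: BalazardDeRoton2008, Prop. 20 (proof)] -/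
theorem card_le_four_mul_of_shift {T M : ℝ} (𝒯 : Finset ℝ) (hT : 0 ≤ T)
    (h𝒯 : ∀ t ∈ 𝒯, T ≤ t ∧ t ≤ 2 * T)
    (hsep : ∀ t ∈ 𝒯, ∀ t' ∈ 𝒯, t ≠ t' → 1 ≤ |t - t'|) (φ : ℝ → ℝ) (hφ : ∀ t ∈ 𝒯, |φ t - t| ≤ 1)
    (hM : ∀ 𝒯' : Finset ℝ, (∀ t' ∈ 𝒯', T - 1 ≤ t' ∧ t' ≤ 2 * T + 1) →
      (∀ t ∈ 𝒯', ∀ t' ∈ 𝒯', t ≠ t' → 1 ≤ |t - t'|) → (∀ t' ∈ 𝒯', ∃ t ∈ 𝒯, φ t = t') →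
      (𝒯'.card : ℝ) ≤ M) :
    (𝒯.card : ℝ) ≤ 4 * M := by
  classical
  set f : ℝ → ℕ := fun t ↦ ⌊t⌋₊ % 4 with hf
  have hmaps : ∀ t ∈ 𝒯, f t ∈ Finset.range 4 := fun t _ ↦ Finset.mem_range.2 (Nat.mod_lt _ (by norm_num))
  have hcard := Finset.card_eq_sum_card_fiberwise hmaps
  -- each class has at most `M` elements
  have hclass : ∀ j ∈ Finset.range 4, ((𝒯.filter fun t ↦ f t = j).card : ℝ) ≤ M := by
    intro j _
    set C := 𝒯.filter fun t ↦ f t = j with hC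
    have hCsub : ∀ t ∈ C, t ∈ 𝒯 := fun t ht ↦ (Finset.mem_filter.1 ht).1
    have hfar : ∀ t ∈ C, ∀ t' ∈ C, t ≠ t' → 3 < |t - t'| := by
      intro t ht t' ht' hne
      have htm := (Finset.mem_filter.1 ht).2
      have ht'm := (Finset.mem_filter.1 ht').2
      have h0 : 0 ≤ t := hT.trans (h𝒯 t (hCsub t ht)).1
      have h0' : 0 ≤ t' := hT.trans (h𝒯 t' (hCsub t' ht')).1
      exact three_lt_abs_sub_of_floor_mod_eq h0 h0' (hsep t (hCsub t ht) t' (hCsub t' ht') hne)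
        (by rw [hf] at htm ht'm; simp only at htm ht'm; rw [htm, ht'm])
    have hφfar : ∀ t ∈ C, ∀ t' ∈ C, t ≠ t' → 1 < |φ t - φ t'| := by
      intro t ht t' ht' hne
      have h3 := hfar t ht t' ht' hne
      have h1 := hφ t (hCsub t ht)
      have h1' := hφ t' (hCsub t' ht')
      have : |t - t'| ≤ |φ t - φ t'| + |φ t - t| + |φ t' - t'| := by
        have := abs_sub_le t (φ t) t'
        have := abs_sub_le (φ t) (φ t') t'
        have e1 : |t - φ t| = |φ t - t| := abs_sub_comm _ _
        have e2 : |t' - φ t'| = |φ t' - t'| := abs_sub_comm _ _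
        linarith [abs_sub_comm (φ t') t']
      linarith
    have hinj : Set.InjOn φ C := by
      intro t ht t' ht' heq
      by_contra hne
      have := hφfar t ht t' ht' hne
      rw [heq, sub_self, abs_zero] at this
      linarith
    rw [← Finset.card_image_of_injOn hinj]
    refine hM (C.image φ) ?_ ?_ ?_
    · intro t' ht'
      obtain ⟨t, ht, rfl⟩ := Finset.mem_image.1 ht'
      have h1 := hφ t (hCsub t ht)
      obtain ⟨hl, hu⟩ := h𝒯 t (hCsub t ht)
      rw [abs_le] at h1
      constructor <;> linarith
    · intro x hx x' hx' hne
      obtain ⟨t, ht, rfl⟩ := Finset.mem_image.1 hx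
      obtain ⟨t', ht', rfl⟩ := Finset.mem_image.1 hx'
      have htt' : t ≠ t' := fun h ↦ hne (by rw [h])
      exact (hφfar t ht t' ht' htt').le
    · intro t' ht'
      obtain ⟨t, ht, rfl⟩ := Finset.mem_image.1 ht'
      exact ⟨t, hCsub t ht, rfl⟩
  have : (𝒯.card : ℝ) = ∑ j ∈ Finset.range 4, ((𝒯.filter fun t ↦ f t = j).card : ℝ) := by
    rw [hcard]; push_cast; rfl
  rw [this]
  calc ∑ j ∈ Finset.range 4, ((𝒯.filter fun t ↦ f t = j).card : ℝ) ≤ ∑ _j ∈ Finset.range 4, M :=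
        Finset.sum_le_sum hclass
    _ = 4 * M := by simp

/-! ## Condition (i): elementary bounds -/

/-- `Σ_{n ≤ x} Λ(n)/(n log n) ≤ 3 (log log x + 4)` for `x ≥ 2` (Mertens for the primes, the proper
prime powers being `O(1)`). [folklore] -/
theorem sum_vonMangoldt_div_mul_log_le {x : ℝ} (hx : 2 ≤ x) :
    ∑ n ∈ Finset.Icc 0 ⌊x⌋₊, (Λ n : ℝ) / (n * Real.log n) ≤ 3 * (Real.log (Real.log x) + 4) := by
  classical
  set g : ℕ → ℝ := fun n ↦ (Λ n : ℝ) / (n * Real.log n) with hg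
  have hg0 : g 0 = 0 := by simp [hg]
  rw [← Finset.sum_Ioc_add_eq_sum_Icc (by omega : 0 ≤ ⌊x⌋₊)]
  show ∑ n ∈ Finset.Ioc 0 ⌊x⌋₊, g n + g 0 ≤ _
  rw [hg0, add_zero, ← Finset.sum_filter_add_sum_filter_not (Finset.Ioc 0 ⌊x⌋₊) Nat.Prime]
  have hprimes : ∑ n ∈ (Finset.Ioc 0 ⌊x⌋₊).filter Nat.Prime, g n =
      ∑ p ∈ (Finset.Ioc 0 ⌊x⌋₊).filter Nat.Prime, (1 / p : ℝ) := by
    refine Finset.sum_congr rfl fun p hp ↦ ?_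
    rw [Finset.mem_filter] at hp
    have hlog : 0 < Real.log p := Real.log_pos (by exact_mod_cast hp.2.one_lt)
    have hp0 : (0 : ℝ) < p := by exact_mod_cast hp.2.pos
    simp only [hg, vonMangoldt_apply_prime hp.2]
    field_simp
  have hrest : ∑ n ∈ (Finset.Ioc 0 ⌊x⌋₊).filter (fun n ↦ ¬ n.Prime), g n ≤
      (1 / 2) * ∑ n ∈ (Finset.Ioc 0 ⌊x⌋₊).filter (fun n ↦ IsPrimePow n ∧ ¬ n.Prime), (1 / Real.sqrt n : ℝ) := by
    rw [← Finset.sum_filter_add_sum_filter_not ((Finset.Ioc 0 ⌊x⌋₊).filter (fun n ↦ ¬ n.Prime)) IsPrimePow]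
    have hzero : ∑ n ∈ ((Finset.Ioc 0 ⌊x⌋₊).filter (fun n ↦ ¬ n.Prime)).filter (fun n ↦ ¬ IsPrimePow n), g n = 0 := by
      refine Finset.sum_eq_zero fun n hn ↦ ?_
      rw [Finset.mem_filter] at hn
      simp only [hg, vonMangoldt_eq_zero_iff.2 hn.2, zero_div]
    rw [hzero, add_zero, Finset.filter_filter, Finset.mul_sum]
    have hset : (Finset.Ioc 0 ⌊x⌋₊).filter (fun n ↦ ¬ n.Prime ∧ IsPrimePow n) =
        (Finset.Ioc 0 ⌊x⌋₊).filter (fun n ↦ IsPrimePow n ∧ ¬ n.Prime) := by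
      ext n; simp only [Finset.mem_filter]; tauto
    rw [hset]
    refine Finset.sum_le_sum fun n hn ↦ ?_
    rw [Finset.mem_filter] at hn
    obtain ⟨hpp, hnp⟩ := hn.2
    -- a proper prime power is `≥ 4`
    have hn4 : 4 ≤ n := by
      obtain ⟨p, k, hp, hk, rfl⟩ := (isPrimePow_nat_iff _).1 hpp
      have hk2 : 2 ≤ k := by
        by_contra h
        have : k = 1 := by omega
        subst this
        exact hnp (by simpa using hp)
      calc 4 = 2 ^ 2 := by norm_num
        _ ≤ p ^ 2 := Nat.pow_le_pow_left hp.two_le 2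
        _ ≤ p ^ k := Nat.pow_le_pow_right hp.pos hk2
    have hn0 : (0 : ℝ) < n := by exact_mod_cast (by omega : 0 < n)
    have hn4r : (4 : ℝ) ≤ n := by exact_mod_cast hn4
    have hlog : 0 < Real.log n := Real.log_pos (by linarith)
    have hsq : 2 ≤ Real.sqrt n := by
      rw [Real.le_sqrt (by norm_num) hn0.le]; linarith
    have hsq0 : 0 < Real.sqrt n := by linarith
    -- `Λ(n)/(n log n) ≤ 1/n = (1/√n)(1/√n) ≤ (1/2)(1/√n)`
    simp only [hg]
    calc (Λ n : ℝ) / (n * Real.log n) ≤ Real.log n / (n * Real.log n) := by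
          gcongr; exact vonMangoldt_le_log
      _ = 1 / n := by field_simp
      _ = (1 / Real.sqrt n) * (1 / Real.sqrt n) := by
          rw [div_mul_div_comm, one_mul, Real.mul_self_sqrt hn0.le]
      _ ≤ (1 / 2) * (1 / Real.sqrt n) := by
          gcongr
  have hpp := sum_properPrimePow_inv_sqrt_le hx
  have hmert := sum_inv_prime_real_le hx
  have hpos : 0 ≤ Real.log (Real.log x) + 4 := by
    have h1 : Real.log 2 ≤ Real.log x := Real.log_le_log (by norm_num) hx
    have h2 : (0.69 : ℝ) < Real.log 2 := by linarith [Real.log_two_gt_d9]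
    have h3 : Real.log (0.69) ≤ Real.log (Real.log x) := Real.log_le_log (by norm_num) (by linarith)
    have h4 : (-1 : ℝ) ≤ Real.log 0.69 := by
      rw [show (-1 : ℝ) = -(1 : ℝ) by ring, ← Real.log_exp 1, ← Real.log_inv]
      refine Real.log_le_log (by positivity) ?_
      have := Real.exp_one_gt_d9
      rw [inv_le_comm₀ (Real.exp_pos 1) (by norm_num)]
      linarith
    linarith
  rw [hprimes]
  nlinarith [hrest, hpp, hmert, hpos]

/-- For `σ ≥ 1` and `n ≤ x`, a term of the smoothed prime sum has modulus `≤ Λ(n)/(n log n)`. [folklore] -/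
theorem norm_term_le_of_one_le {x σ t : ℝ} (hx : 1 < x) (hσ : 1 ≤ σ) {n : ℕ} (hn : n ∈ Finset.Icc 0 ⌊x⌋₊) :
    ‖(Λ n : ℂ) / ((n : ℂ) ^ ((σ : ℂ) + (t : ℂ) * I) * (Real.log n : ℂ)) * ((Real.log (x / n) / Real.log x : ℝ) : ℂ)‖ ≤
      (Λ n : ℝ) / (n * Real.log n) := by
  have hlogx : 0 < Real.log x := Real.log_pos hx
  rcases Nat.lt_or_ge n 2 with hn2 | hn2
  · interval_cases n <;> simp
  have hn0 : (0 : ℝ) < n := by exact_mod_cast (by omega : 0 < n)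
  have hn1 : (1 : ℝ) ≤ n := by exact_mod_cast (by omega : 1 ≤ n)
  have hnx : (n : ℝ) ≤ x := by
    rw [Finset.mem_Icc] at hn
    exact (Nat.cast_le.2 hn.2).trans (Nat.floor_le (by linarith))
  have hlogn : 0 < Real.log n := Real.log_pos (by exact_mod_cast hn2)
  have hw0 : 0 ≤ Real.log (x / n) := Real.log_nonneg (by rw [le_div_iff₀ hn0]; linarith)
  have hw1 : Real.log (x / n) / Real.log x ≤ 1 := by
    rw [div_le_one hlogx]
    exact Real.log_le_log (by positivity) (by rw [div_le_iff₀ hn0]; nlinarith)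
  have hpow : ‖(n : ℂ) ^ ((σ : ℂ) + (t : ℂ) * I)‖ = (n : ℝ) ^ σ := by
    rw [Complex.norm_natCast_cpow_of_pos (by omega)]
    simp
  have hpow_ge : (n : ℝ) ≤ (n : ℝ) ^ σ := by
    conv_lhs => rw [← Real.rpow_one (n : ℝ)]
    exact Real.rpow_le_rpow_of_exponent_le hn1 hσ
  rw [norm_mul, norm_div, norm_mul, hpow, Complex.norm_real, Complex.norm_real, Complex.norm_real,
    Real.norm_eq_abs, Real.norm_eq_abs, Real.norm_eq_abs, abs_of_nonneg vonMangoldt_nonneg,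
    abs_of_pos hlogn, abs_of_nonneg (div_nonneg hw0 hlogx.le)]
  calc (Λ n : ℝ) / ((n : ℝ) ^ σ * Real.log n) * (Real.log (x / n) / Real.log x)
      ≤ (Λ n : ℝ) / ((n : ℝ) ^ σ * Real.log n) * 1 := by gcongr
    _ ≤ (Λ n : ℝ) / (n * Real.log n) := by
        rw [mul_one]
        exact div_le_div_of_nonneg_left vonMangoldt_nonneg (by positivity)
          (mul_le_mul_of_nonneg_right hpow_ge hlogn.le)

/-- **For `σ ≥ 1` the smoothed prime sum is `O(log log x)`:** `‖typicalPrimeSum T V σ t‖ ≤ 3(log log x + 4)`,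
`x = T^{1/V} ≥ 2`. [cite: BalazardDeRoton2008, Prop. 20 (proof of (i))] -/
theorem norm_typicalPrimeSum_le_of_one_le {T V σ t : ℝ} (hx : 2 ≤ T ^ (1 / V)) (hσ : 1 ≤ σ) :
    ‖typicalPrimeSum T V σ t‖ ≤ 3 * (Real.log (Real.log (T ^ (1 / V))) + 4) := by
  set x : ℝ := T ^ (1 / V) with hxdef
  have hx1 : 1 < x := by linarith
  unfold typicalPrimeSum
  rw [← hxdef]
  refine (norm_sum_le _ _).trans ?_
  refine (Finset.sum_le_sum fun n hn ↦ norm_term_le_of_one_le (t := t) hx1 hσ hn).trans ?_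
  exact sum_vonMangoldt_div_mul_log_le hx

/-- The prime terms of the smoothed sum: for a prime `p`,
`Λ(p)/(p^{σ+it} log p) · w = w · p^{−(σ+it)}`. [folklore] -/
theorem prime_term_eq {p : ℕ} (hp : p.Prime) (σ t w : ℝ) :
    (Λ p : ℂ) / ((p : ℂ) ^ ((σ : ℂ) + (t : ℂ) * I) * (Real.log p : ℂ)) * ((w : ℝ) : ℂ) =
      (w : ℂ) * (p : ℂ) ^ (-((σ : ℂ) + (t : ℂ) * I)) := by
  have hlog : (Real.log p : ℂ) ≠ 0 := by
    rw [Complex.ofReal_ne_zero]; exact (Real.log_pos (by exact_mod_cast hp.one_lt)).ne'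
  have hp0 : (p : ℂ) ≠ 0 := Nat.cast_ne_zero.2 hp.ne_zero
  have hps : (p : ℂ) ^ ((σ : ℂ) + (t : ℂ) * I) ≠ 0 := by
    rw [Complex.cpow_def_of_ne_zero hp0]; exact Complex.exp_ne_zero _
  rw [vonMangoldt_apply_prime hp, Complex.cpow_neg]
  field_simp

/-- The remainder of the smoothed prime sum after the primes: for `σ ≥ 1/2` and `x = T^{1/V} ≥ 2`,
`‖typicalPrimeSum T V σ t − Σ_{p ≤ x} w_p p^{−(σ+it)}‖ ≤ (7/2)(log log x + 4)`, `w_p = log(x/p)/log x`.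
[cite: BalazardDeRoton2008, Prop. 20 (proof of (i))] -/
theorem norm_typicalPrimeSum_sub_primePart_le {T V σ t : ℝ} (hx : 2 ≤ T ^ (1 / V)) (hσ : 1 / 2 ≤ σ) :
    ‖typicalPrimeSum T V σ t -
        ∑ p ∈ (Finset.Ioc 0 ⌊T ^ (1 / V)⌋₊).filter Nat.Prime,
          ((Real.log (T ^ (1 / V) / p) / Real.log (T ^ (1 / V)) : ℝ) : ℂ) * (p : ℂ) ^ (-((σ : ℂ) + (t : ℂ) * I))‖ ≤
      (7 / 2) * (Real.log (Real.log (T ^ (1 / V))) + 4) := by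
  classical
  set x : ℝ := T ^ (1 / V) with hxdef
  have hx1 : 1 < x := by linarith
  have hlogx : 0 < Real.log x := Real.log_pos hx1
  set term : ℕ → ℂ := fun n ↦ (Λ n : ℂ) / ((n : ℂ) ^ ((σ : ℂ) + (t : ℂ) * I) * (Real.log n : ℂ)) *
    ((Real.log (x / n) / Real.log x : ℝ) : ℂ) with hterm
  have htps : typicalPrimeSum T V σ t = ∑ n ∈ Finset.Icc 0 ⌊x⌋₊, term n := by
    unfold typicalPrimeSum; rw [← hxdef]
  have h0 : term 0 = 0 := by simp [hterm]
  have hsplit : ∑ n ∈ Finset.Icc 0 ⌊x⌋₊, term n =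
      ∑ n ∈ (Finset.Ioc 0 ⌊x⌋₊).filter Nat.Prime, term n +
        ∑ n ∈ (Finset.Ioc 0 ⌊x⌋₊).filter (fun n ↦ ¬ n.Prime), term n := by
    rw [← Finset.sum_Ioc_add_eq_sum_Icc (by omega : 0 ≤ ⌊x⌋₊), h0, add_zero,
      Finset.sum_filter_add_sum_filter_not]
  have hprimes : ∑ n ∈ (Finset.Ioc 0 ⌊x⌋₊).filter Nat.Prime, term n =
      ∑ p ∈ (Finset.Ioc 0 ⌊x⌋₊).filter Nat.Prime,
        ((Real.log (x / p) / Real.log x : ℝ) : ℂ) * (p : ℂ) ^ (-((σ : ℂ) + (t : ℂ) * I)) := by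
    refine Finset.sum_congr rfl fun p hp ↦ ?_
    rw [Finset.mem_filter] at hp
    exact prime_term_eq hp.2 σ t _
  rw [htps, hsplit, hprimes, add_sub_cancel_left]
  refine (norm_sum_le _ _).trans ?_
  -- each non-prime term: `≤ 1/√n` on proper prime powers, `0` otherwise
  rw [← Finset.sum_filter_add_sum_filter_not ((Finset.Ioc 0 ⌊x⌋₊).filter (fun n ↦ ¬ n.Prime)) IsPrimePow]
  have hzero : ∑ n ∈ ((Finset.Ioc 0 ⌊x⌋₊).filter (fun n ↦ ¬ n.Prime)).filter (fun n ↦ ¬ IsPrimePow n), ‖term n‖ = 0 := by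
    refine Finset.sum_eq_zero fun n hn ↦ ?_
    rw [Finset.mem_filter] at hn
    simp [hterm, vonMangoldt_eq_zero_iff.2 hn.2]
  rw [hzero, add_zero, Finset.filter_filter]
  have hset : (Finset.Ioc 0 ⌊x⌋₊).filter (fun n ↦ ¬ n.Prime ∧ IsPrimePow n) =
      (Finset.Ioc 0 ⌊x⌋₊).filter (fun n ↦ IsPrimePow n ∧ ¬ n.Prime) := by
    ext n; simp only [Finset.mem_filter]; tauto
  rw [hset]
  have hbound : ∀ n ∈ (Finset.Ioc 0 ⌊x⌋₊).filter (fun n ↦ IsPrimePow n ∧ ¬ n.Prime), ‖term n‖ ≤ 1 / Real.sqrt n := by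
    intro n hn
    rw [Finset.mem_filter, Finset.mem_Ioc] at hn
    have hnI : n ∈ Finset.Icc 0 ⌊x⌋₊ := Finset.mem_Icc.2 ⟨Nat.zero_le _, hn.1.2⟩
    refine (norm_term_le (t := t) hx1 hσ hnI).trans ?_
    have hw1 : Real.log (x / n) / Real.log x ≤ 1 := by
      have hn0 : (0 : ℝ) < n := by exact_mod_cast hn.1.1
      rw [div_le_one hlogx]
      refine Real.log_le_log (by positivity) ?_
      rw [div_le_iff₀ hn0]
      have : (1 : ℝ) ≤ n := by exact_mod_cast hn.1.1
      nlinarith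
    obtain ⟨h1, h2⟩ := vonMangoldt_div_sqrt_log_le n
    calc (Λ n : ℝ) / (Real.sqrt n * Real.log n) * Real.log (x / n) / Real.log x
        = (Λ n : ℝ) / (Real.sqrt n * Real.log n) * (Real.log (x / n) / Real.log x) := by ring
      _ ≤ (Λ n : ℝ) / (Real.sqrt n * Real.log n) * 1 := by gcongr
      _ ≤ 1 / Real.sqrt n := by rw [mul_one]; exact h2
  refine (Finset.sum_le_sum hbound).trans ?_
  refine (sum_properPrimePow_inv_sqrt_le hx).trans ?_
  have := sum_inv_prime_real_le hx
  nlinarith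

/-! ## Counting the ordinates violating (i) -/

/-- Eventual conditions on `a = log T` for the count of (i)-violations. [folklore] -/
theorem eventually_conditions_i :
    ∀ᶠ a : ℝ in atTop, 4 ≤ a ∧ 6 ≤ Real.log a := by
  have hlog : Tendsto Real.log atTop atTop := Real.tendsto_log_atTop
  filter_upwards [eventually_ge_atTop 4, hlog.eventually_ge_atTop 6] with a h1 h2
  exact ⟨h1, h2⟩

/-- **The ordinates violating (i) are few** (no hypothesis beyond the definitions): there is `T₀`
such that for `T ≥ T₀`, `2 (log log T)² ≤ V ≤ log T/log log T`, and a finite `1`-spaced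
`𝒯 ⊂ [T, 2T]` with `∀ t ∈ 𝒯, ∃ σ ≥ 1/2, ‖typicalPrimeSum T V σ t‖ > 2V`,
`#𝒯 ≤ T exp(−V log(V/log log T) + 4V)`. [cite: BalazardDeRoton2008, Prop. 20 (proof of (i))] -/
theorem card_fail_primeSum_le :
    ∃ T₀ : ℝ, ∀ T : ℝ, T₀ ≤ T → ∀ V : ℝ,
      2 * Real.log (Real.log T) ^ 2 ≤ V → V ≤ Real.log T / Real.log (Real.log T) →
      ∀ 𝒯 : Finset ℝ, (∀ t ∈ 𝒯, T ≤ t ∧ t ≤ 2 * T) →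
      (∀ t ∈ 𝒯, ∀ t' ∈ 𝒯, t ≠ t' → 1 ≤ |t - t'|) →
      (∀ t ∈ 𝒯, ∃ σ : ℝ, 1 / 2 ≤ σ ∧ 2 * V < ‖typicalPrimeSum T V σ t‖) →
      (𝒯.card : ℝ) ≤ T * Real.exp (-V * Real.log (V / Real.log (Real.log T)) + 4 * V) := by
  classical
  obtain ⟨a₀, ha₀⟩ := Filter.eventually_atTop.1 eventually_conditions_i
  refine ⟨Real.exp a₀, fun T hT V hVl hVu 𝒯 h𝒯 hsep hfail ↦ ?_⟩
  have hT0 : 0 < T := (Real.exp_pos a₀).trans_le hT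
  set a : ℝ := Real.log T with ha
  have haa₀ : a₀ ≤ a := by rw [ha, ← Real.log_exp a₀]; exact Real.log_le_log (Real.exp_pos _) hT
  obtain ⟨ha4, hb6⟩ := ha₀ a haa₀
  set b : ℝ := Real.log a with hb
  have hb0 : 0 < b := by linarith only [hb6]
  have ha0 : 0 < a := by linarith only [ha4]
  have hTa : Real.exp a = T := by rw [ha, Real.exp_log hT0]
  have haT : a + 1 ≤ T := by rw [← hTa]; exact Real.add_one_le_exp a
  have hT1 : 1 ≤ T := by linarith only [haT, ha4]
  have hV72 : (72 : ℝ) ≤ V := by nlinarith only [hb6, hVl]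
  have hV0 : 0 < V := by linarith only [hV72]
  have hVa : V * b ≤ a := by rwa [le_div_iff₀ hb0] at hVu
  have hbV : b ≤ V := by nlinarith only [hb6, hVl]
  -- `x = T^{1/V}`, `log x = a/V ∈ [b, a]`
  set x : ℝ := T ^ (1 / V) with hxdef
  have hlogx : Real.log x = a / V := by rw [hxdef, Real.log_rpow hT0, ha]; ring
  have hlogx_ge : b ≤ Real.log x := by rw [hlogx, le_div_iff₀ hV0]; linarith only [hVa, mul_comm V b]
  have hlogx_le : Real.log x ≤ a := by
    rw [hlogx, div_le_iff₀ hV0]; nlinarith only [hV72, ha0]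
  have hx0 : 0 < x := Real.rpow_pos_of_pos hT0 _
  have hx2 : (2 : ℝ) ≤ x := by
    have h1 : Real.log 2 ≤ Real.log x := by
      have : Real.log 2 < 1 := by have := Real.log_two_lt_d9; linarith
      linarith only [this, hlogx_ge, hb6]
    exact (Real.log_le_log_iff (by norm_num) hx0).1 h1
  have hLLx : Real.log (Real.log x) + 4 ≤ b + 4 := by
    have : Real.log (Real.log x) ≤ b := by rw [hb]; exact Real.log_le_log (by linarith only [hlogx_ge, hb0]) hlogx_le
    linarith only [this]
  have hLL0 : 0 ≤ Real.log (Real.log x) := Real.log_nonneg (by linarith only [hlogx_ge, hb6])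
  -- the prime set and weights
  set N : ℕ := ⌊x⌋₊ with hN
  set P : Finset ℕ := (Finset.Ioc 0 N).filter Nat.Prime with hP
  have hPprime : ∀ p ∈ P, p.Prime := fun p hp ↦ (Finset.mem_filter.1 hp).2
  have hPN : ∀ p ∈ P, p ≤ N := fun p hp ↦ (Finset.mem_Ioc.1 (Finset.mem_filter.1 hp).1).2
  have hN1 : 1 ≤ N := by rw [hN]; exact Nat.le_floor (by simp only [Nat.cast_one]; linarith only [hx2])
  set w : ℕ → ℝ := fun p ↦ Real.log (x / p) / Real.log x with hw
  have hw01 : ∀ p ∈ P, 0 ≤ w p ∧ w p ≤ 1 := by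
    intro p hp
    have hp0 : (0 : ℝ) < p := by exact_mod_cast (hPprime p hp).pos
    have hp1 : (1 : ℝ) ≤ p := by exact_mod_cast (hPprime p hp).one_lt.le
    have hpx : (p : ℝ) ≤ x := (Nat.cast_le.2 (hPN p hp)).trans (Nat.floor_le hx0.le)
    have hlx : 0 < Real.log x := by linarith only [hlogx_ge, hb0]
    refine ⟨div_nonneg (Real.log_nonneg (by rw [le_div_iff₀ hp0]; linarith)) hlx.le, ?_⟩
    rw [hw, div_le_one hlx]
    exact Real.log_le_log (by positivity) (by rw [div_le_iff₀ hp0]; nlinarith)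
  -- choice of `σ_t ∈ [1/2, 1)` and the lower bound `‖P(σ_t + it)‖ ≥ V`
  have hchoice : ∀ t ∈ 𝒯, ∃ σ : ℝ, 1 / 2 ≤ σ ∧ σ ≤ 1 ∧
      V ≤ ‖∑ p ∈ P, (w p : ℂ) * (p : ℂ) ^ (-((σ : ℂ) + (t : ℂ) * I))‖ := by
    intro t ht
    obtain ⟨σ, hσ, hbig⟩ := hfail t ht
    have hσ1 : σ ≤ 1 := by
      by_contra hσ1
      rw [not_le] at hσ1
      have := norm_typicalPrimeSum_le_of_one_le (t := t) hx2 hσ1.le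
      rw [← hxdef] at this
      nlinarith only [this, hbig, hLLx, hVl, hb6]
    refine ⟨σ, hσ, hσ1, ?_⟩
    have hrem := norm_typicalPrimeSum_sub_primePart_le (t := t) hx2 hσ
    have htri := norm_sub_norm_le (typicalPrimeSum T V σ t)
      (∑ p ∈ P, (w p : ℂ) * (p : ℂ) ^ (-((σ : ℂ) + (t : ℂ) * I)))
    have h72 : (7 / 2 : ℝ) * (b + 4) ≤ V := by nlinarith only [hb6, hVl]
    linarith only [hrem, htri, hbig, h72, hLLx]
  -- the points `σ_t + it`
  set σf : ℝ → ℝ := fun t ↦ if ht : t ∈ 𝒯 then Classical.choose (hchoice t ht) else 1 / 2 with hσf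
  have hσf : ∀ t ∈ 𝒯, 1 / 2 ≤ σf t ∧ σf t ≤ 1 ∧
      V ≤ ‖∑ p ∈ P, (w p : ℂ) * (p : ℂ) ^ (-((σf t : ℂ) + (t : ℂ) * I))‖ := by
    intro t ht
    have := Classical.choose_spec (hchoice t ht)
    simp only [hσf, dif_pos ht]
    exact this
  set ψ : ℝ → ℂ := fun t ↦ (σf t : ℂ) + (t : ℂ) * I with hψ
  have hψim : ∀ t, (ψ t).im = t := fun t ↦ by simp [hψ]
  have hψre : ∀ t, (ψ t).re = σf t := fun t ↦ by simp [hψ]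
  have hψinj : Function.Injective ψ := fun t t' h ↦ by
    have := congrArg Complex.im h; rwa [hψim, hψim] at this
  set 𝒮 : Finset ℂ := 𝒯.image ψ with h𝒮
  -- Prop. 13 in the strip `1/2 ≤ Re s ≤ 1`
  set k : ℕ := ⌊V⌋₊ with hk
  have hkV : (k : ℝ) ≤ V := Nat.floor_le hV0.le
  have hkV1 : V - 1 ≤ k := by
    have := Nat.lt_floor_add_one V; rw [← hk] at this; linarith only [this]
  have hNT : ((N ^ k : ℕ) : ℝ) ≤ 2 * T := by
    have hNx : (N : ℝ) ≤ x := Nat.floor_le hx0.le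
    push_cast
    calc (N : ℝ) ^ k ≤ x ^ k := pow_le_pow_left₀ (Nat.cast_nonneg _) hNx k
      _ = T ^ ((k : ℝ) / V) := by
          rw [hxdef, ← Real.rpow_natCast, ← Real.rpow_mul hT0.le]; congr 1; ring
      _ ≤ T ^ (1 : ℝ) := Real.rpow_le_rpow_of_exponent_le hT1 (by rw [div_le_one hV0]; exact hkV)
      _ = T := Real.rpow_one T
      _ ≤ 2 * T := by linarith only [hT0]
  have h13 := sum_norm_primePoly_pow_le_strip P hPprime hN1 hPN (fun p ↦ (w p : ℂ)) k
    (show (1 : ℝ) ≤ 2 * T by linarith only [hT1]) (by norm_num : (0 : ℝ) < 1 / 2) (α := 1 / 2) hNT 𝒮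
    (fun s hs ↦ by
      obtain ⟨t, ht, rfl⟩ := Finset.mem_image.1 hs
      rw [hψre]; obtain ⟨h1, h2, _⟩ := hσf t ht; exact ⟨h1, by linarith only [h2]⟩)
    (fun s hs ↦ by
      obtain ⟨t, ht, rfl⟩ := Finset.mem_image.1 hs
      rw [hψim]; obtain ⟨h1, h2⟩ := h𝒯 t ht
      rw [abs_of_pos (by linarith only [h1, hT0])]; exact h2)
    (fun s hs s' hs' hne ↦ by
      obtain ⟨t, ht, rfl⟩ := Finset.mem_image.1 hs
      obtain ⟨t', ht', rfl⟩ := Finset.mem_image.1 hs'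
      rw [hψim, hψim]
      exact hsep t ht t' ht' fun h ↦ hne (by rw [h]))
  -- the weight sum `Σ w_p² p^{-1} ≤ log log x + 4 ≤ b + 4`
  have hW : ∑ p ∈ P, ‖(w p : ℂ)‖ ^ 2 * (p : ℝ) ^ (-(2 * (1 / 2 : ℝ))) ≤ b + 4 := by
    have hmert := sum_inv_prime_real_le hx2
    refine le_trans ?_ (hmert.trans hLLx)
    refine Finset.sum_le_sum fun p hp ↦ ?_
    have hp0 : (0 : ℝ) < p := by exact_mod_cast (hPprime p hp).pos
    obtain ⟨h0, h1⟩ := hw01 p hp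
    rw [Complex.norm_real, Real.norm_eq_abs, abs_of_nonneg h0, show (-(2 * (1 / 2 : ℝ))) = -1 by norm_num,
      Real.rpow_neg_one, one_div]
    calc w p ^ 2 * (p : ℝ)⁻¹ ≤ 1 ^ 2 * (p : ℝ)⁻¹ := by gcongr
      _ = (p : ℝ)⁻¹ := by ring
  -- lower bound at each point and the count
  have hcount : (𝒯.card : ℝ) * V ^ (2 * k) ≤
      ∑ s ∈ 𝒮, ‖∑ p ∈ P, (w p : ℂ) * (p : ℂ) ^ (-s)‖ ^ (2 * k) := by
    rw [h𝒮, Finset.sum_image fun t _ t' _ h ↦ hψinj h, ← Finset.card_image_of_injective 𝒯 hψinj,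
      Finset.card_image_of_injective 𝒯 hψinj]
    have := Finset.card_nsmul_le_sum 𝒯 (fun t ↦ ‖∑ p ∈ P, (w p : ℂ) * (p : ℂ) ^ (-ψ t)‖ ^ (2 * k))
      (V ^ (2 * k)) (fun t ht ↦ pow_le_pow_left₀ hV0.le (hσf t ht).2.2 _)
    rwa [nsmul_eq_mul] at this
  have hmain : (𝒯.card : ℝ) * V ^ (2 * k) ≤
      52 * T * (1 + Real.log (2 * T)) ^ 2 * (k.factorial * (b + 4) ^ k) := by
    refine (hcount.trans h13).trans ?_
    have hlog2T : 0 ≤ Real.log (2 * T) := Real.log_nonneg (by linarith only [hT1])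
    have hWk : (∑ p ∈ P, ‖(w p : ℂ)‖ ^ 2 * (p : ℝ) ^ (-(2 * (1 / 2 : ℝ)))) ^ k ≤ (b + 4) ^ k :=
      pow_le_pow_left₀ (Finset.sum_nonneg fun p _ ↦ by positivity) hW k
    calc 26 * (2 * T) * (1 + Real.log (2 * T)) * (1 + 2 * (1 / 2) * Real.log (2 * T)) *
          (k.factorial * (∑ p ∈ P, ‖(w p : ℂ)‖ ^ 2 * (p : ℝ) ^ (-(2 * (1 / 2 : ℝ)))) ^ k)
        ≤ 26 * (2 * T) * (1 + Real.log (2 * T)) * (1 + 2 * (1 / 2) * Real.log (2 * T)) *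
          (k.factorial * (b + 4) ^ k) := by gcongr
      _ = 52 * T * (1 + Real.log (2 * T)) ^ 2 * (k.factorial * (b + 4) ^ k) := by ring
  -- arithmetic: `k! (b+4)^k ≤ V^k (b+4)^k`, cancel `V^k`
  have hfac : (k.factorial : ℝ) ≤ V ^ k := by
    calc (k.factorial : ℝ) ≤ (k : ℝ) ^ k := by exact_mod_cast Nat.factorial_le_pow k
      _ ≤ V ^ k := pow_le_pow_left₀ (Nat.cast_nonneg _) hkV k
  have hVk : 0 < V ^ k := pow_pos hV0 k
  have hstep : (𝒯.card : ℝ) * V ^ k ≤ 52 * T * (1 + Real.log (2 * T)) ^ 2 * (b + 4) ^ k := by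
    have h1 : (𝒯.card : ℝ) * V ^ (2 * k) ≤ 52 * T * (1 + Real.log (2 * T)) ^ 2 * (V ^ k * (b + 4) ^ k) := by
      refine hmain.trans ?_
      have : 0 ≤ 52 * T * (1 + Real.log (2 * T)) ^ 2 := by positivity
      have h2 : (k.factorial : ℝ) * (b + 4) ^ k ≤ V ^ k * (b + 4) ^ k :=
        mul_le_mul_of_nonneg_right hfac (by positivity)
      exact mul_le_mul_of_nonneg_left h2 this
    rw [pow_mul', sq] at h1
    have h1' : ((𝒯.card : ℝ) * V ^ k) * V ^ k ≤ (52 * T * (1 + Real.log (2 * T)) ^ 2 * (b + 4) ^ k) * V ^ k := by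
      calc ((𝒯.card : ℝ) * V ^ k) * V ^ k = (𝒯.card : ℝ) * (V ^ k * V ^ k) := by ring
        _ ≤ 52 * T * (1 + Real.log (2 * T)) ^ 2 * (V ^ k * (b + 4) ^ k) := h1
        _ = (52 * T * (1 + Real.log (2 * T)) ^ 2 * (b + 4) ^ k) * V ^ k := by ring
    exact le_of_mul_le_mul_right h1' hVk
  -- `(b+4)^k / V^k = exp(k log((b+4)/V)) ≤ exp(−V log(V/b) + 2V)`
  have hb4V : b + 4 ≤ V := by nlinarith only [hb6, hVl]
  have hratio : (b + 4) ^ k ≤ V ^ k * Real.exp (-V * Real.log (V / b) + 2 * V) := by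
    have hq0 : 0 < (b + 4) / V := by positivity
    have hq : (b + 4) ^ k = V ^ k * ((b + 4) / V) ^ k := by
      rw [← mul_pow]; congr 1; field_simp
    rw [hq]
    refine mul_le_mul_of_nonneg_left ?_ hVk.le
    rw [← Real.exp_log (pow_pos hq0 k), Real.log_pow]
    refine Real.exp_le_exp.2 ?_
    have hlogq : Real.log ((b + 4) / V) = -Real.log (V / (b + 4)) := by
      rw [← Real.log_inv]; congr 1; rw [inv_div]
    have hlog0 : 0 ≤ Real.log (V / (b + 4)) := Real.log_nonneg (by rw [le_div_iff₀ (by positivity)]; linarith only [hb4V])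
    have hlogV : Real.log (V / (b + 4)) ≤ V := by
      have h1 : Real.log (V / (b + 4)) ≤ Real.log V := Real.log_le_log (by positivity)
        (by rw [div_le_iff₀ (by positivity)]; nlinarith only [hb6, hV0])
      have h2 : Real.log V ≤ V - 1 := Real.log_le_sub_one_of_pos hV0
      linarith only [h1, h2]
    -- `log(V/(b+4)) ≥ log(V/b) − 4/b ≥ log(V/b) − 1`
    have hsplit : Real.log (V / b) ≤ Real.log (V / (b + 4)) + 1 := by
      have : Real.log (V / b) = Real.log (V / (b + 4)) + Real.log ((b + 4) / b) := by
        rw [← Real.log_mul (by positivity) (by positivity)]; congr 1; field_simp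
      rw [this]
      have h3 : Real.log ((b + 4) / b) ≤ (b + 4) / b - 1 := Real.log_le_sub_one_of_pos (by positivity)
      have h4 : (b + 4) / b - 1 ≤ 1 := by rw [div_sub_one hb0.ne', div_le_one hb0]; linarith only [hb6]
      linarith only [h3, h4]
    calc (k : ℝ) * Real.log ((b + 4) / V) = -((k : ℝ) * Real.log (V / (b + 4))) := by rw [hlogq]; ring
      _ ≤ -((V - 1) * Real.log (V / (b + 4))) := by
          have := mul_le_mul_of_nonneg_right hkV1 hlog0
          linarith only [this]
      _ = -V * Real.log (V / (b + 4)) + Real.log (V / (b + 4)) := by ring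
      _ ≤ -V * Real.log (V / b) + V + V := by nlinarith only [hsplit, hlogV, hV0, hlog0]
      _ = -V * Real.log (V / b) + 2 * V := by ring
  -- `52 (1 + log 2T)² ≤ exp(2b + 6) ≤ exp(2V)`
  have hconst : 52 * (1 + Real.log (2 * T)) ^ 2 ≤ Real.exp (2 * V) := by
    have hl2T : 1 + Real.log (2 * T) ≤ a + 2 := by
      rw [Real.log_mul (by norm_num) hT0.ne', ← ha]
      have : Real.log 2 < 1 := by have := Real.log_two_lt_d9; linarith
      linarith only [this]
    have hl0 : 0 ≤ 1 + Real.log (2 * T) := by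
      have := Real.log_nonneg (show (1 : ℝ) ≤ 2 * T by linarith only [hT1]); linarith only [this]
    have he6 : (387 : ℝ) ≤ Real.exp 6 := by
      have h27 : (2.7 : ℝ) ≤ Real.exp 1 := by linarith [Real.exp_one_gt_d9]
      have : Real.exp 6 = Real.exp 1 ^ 6 := by rw [← Real.exp_nat_mul]; norm_num
      rw [this]
      have h66 := pow_le_pow_left₀ (by norm_num : (0 : ℝ) ≤ 2.7) h27 6
      have : (387 : ℝ) ≤ (2.7 : ℝ) ^ 6 := by norm_num
      linarith only [h66, this]
    have h2b : Real.exp (2 * b + 6) = a ^ 2 * Real.exp 6 := by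
      rw [Real.exp_add, show 2 * b = (2 : ℕ) * b by norm_num, Real.exp_nat_mul, hb, Real.exp_log ha0]
    have hstep1 : 52 * (1 + Real.log (2 * T)) ^ 2 ≤ 52 * (a + 2) ^ 2 := by gcongr
    have hstep2 : 52 * (a + 2) ^ 2 ≤ a ^ 2 * Real.exp 6 := by
      have h1 := mul_le_mul_of_nonneg_left he6 (sq_nonneg a)
      have ha16 : 16 ≤ a ^ 2 := by nlinarith only [ha4]
      nlinarith only [h1, ha4, ha16]
    have hstep3 : Real.exp (2 * b + 6) ≤ Real.exp (2 * V) := Real.exp_le_exp.2 (by nlinarith only [hb6, hVl])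
    linarith only [hstep1, hstep2, h2b, hstep3]
  -- conclude
  have hfin : (𝒯.card : ℝ) * V ^ k ≤ (T * Real.exp (-V * Real.log (V / b) + 4 * V)) * V ^ k := by
    calc (𝒯.card : ℝ) * V ^ k ≤ 52 * T * (1 + Real.log (2 * T)) ^ 2 * (b + 4) ^ k := hstep
      _ = T * (52 * (1 + Real.log (2 * T)) ^ 2) * (b + 4) ^ k := by ring
      _ ≤ T * Real.exp (2 * V) * (V ^ k * Real.exp (-V * Real.log (V / b) + 2 * V)) := by gcongr
      _ = (T * (Real.exp (2 * V) * Real.exp (-V * Real.log (V / b) + 2 * V))) * V ^ k := by ring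
      _ = (T * Real.exp (-V * Real.log (V / b) + 4 * V)) * V ^ k := by
          rw [← Real.exp_add]; congr 2; ring
  exact le_of_mul_le_mul_right hfin hVk

/-! ## Counting the ordinates violating (ii) or (iii): windows with too many zeros -/

/-- **Crowded windows near well-spaced ordinates are few** (Prop. 17 + the four-classes trick):
under RH there is `T₀` such that for `T ≥ T₀`, `0 < h ≤ 1`, `(log log T)² ≤ W ≤ log T/log log T`,
`B ≥ W + (h/π) log((2T+2)/2π)`, and every finite `1`-spaced `𝒯 ⊂ [T, 2T]` each of whose points
`t` has a window `]u, u+2h] ⊂ [t−1, t+1]` with `N(u+2h) − N(u) > B`,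
`#𝒯 ≤ 4T exp(−W log(W/log log T) + 2W log log W + 8W)`. [cite: BalazardDeRoton2008, Prop. 20 (proof of (ii), (iii))] -/
theorem card_fail_window_le_of_RH (hRH : RiemannHypothesis) :
    ∃ T₀ : ℝ, ∀ T : ℝ, T₀ ≤ T → ∀ h : ℝ, 0 < h → h ≤ 1 → ∀ W B : ℝ,
      Real.log (Real.log T) ^ 2 ≤ W → W ≤ Real.log T / Real.log (Real.log T) →
      W + h / π * Real.log ((2 * T + 2) / (2 * π)) ≤ B →
      ∀ 𝒯 : Finset ℝ, (∀ t ∈ 𝒯, T ≤ t ∧ t ≤ 2 * T) →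
      (∀ t ∈ 𝒯, ∀ t' ∈ 𝒯, t ≠ t' → 1 ≤ |t - t'|) →
      (∀ t ∈ 𝒯, ∃ u : ℝ, t - 1 ≤ u ∧ u + 2 * h ≤ t + 1 ∧
        B < ((zetaZeroCount (u + 2 * h) : ℝ) - zetaZeroCount u)) →
      (𝒯.card : ℝ) ≤ 4 * (T * Real.exp (-W * Real.log (W / Real.log (Real.log T)) +
        2 * W * Real.log (Real.log W) + 8 * W)) := by
  classical
  obtain ⟨T₁, hT₁⟩ := card_deviations_le_of_RH hRH
  refine ⟨max T₁ 1, fun T hT h hh0 hh1 W B hWl hWu hWB 𝒯 h𝒯 hsep hfail ↦ ?_⟩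
  have hTT₁ : T₁ ≤ T := (le_max_left _ _).trans hT
  have hT1 : 1 ≤ T := (le_max_right _ _).trans hT
  have hπ := Real.pi_pos
  set φ : ℝ → ℝ := fun t ↦ if ht : t ∈ 𝒯 then Classical.choose (hfail t ht) + h else t with hφdef
  have hφ : ∀ t ∈ 𝒯, t - 1 ≤ φ t - h ∧ φ t - h + 2 * h ≤ t + 1 ∧
      B < ((zetaZeroCount (φ t - h + 2 * h) : ℝ) - zetaZeroCount (φ t - h)) := by
    intro t ht
    have := Classical.choose_spec (hfail t ht)
    simp only [hφdef, dif_pos ht, add_sub_cancel_right]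
    exact this
  refine card_le_four_mul_of_shift 𝒯 (by linarith) h𝒯 hsep φ (fun t ht ↦ ?_) (fun 𝒯' h𝒯' hsep' hprov ↦ ?_)
  · obtain ⟨h1, h2, _⟩ := hφ t ht
    rw [abs_le]; constructor <;> linarith
  · refine hT₁ T hTT₁ h hh0 hh1 W hWl hWu 𝒯' h𝒯' hsep' fun t' ht' ↦ ?_
    obtain ⟨t, ht, rfl⟩ := hprov t' ht'
    obtain ⟨h1, h2, h3⟩ := hφ t ht
    obtain ⟨htT, _⟩ := h𝒯 t ht
    have e1 : φ t - h + 2 * h = φ t + h := by ring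
    rw [e1] at h3
    -- `(h/π) log(t'/2π) ≤ (h/π) log((2T+2)/2π)`
    have ht'0 : 0 < φ t := by linarith
    have hlog : h / π * Real.log (φ t / (2 * π)) ≤ h / π * Real.log ((2 * T + 2) / (2 * π)) := by
      refine mul_le_mul_of_nonneg_left (Real.log_le_log (by positivity) ?_) (by positivity)
      rw [div_le_div_iff_of_pos_right (by positivity)]; linarith
    linarith

/-- The exponent of Prop. 17 at `W = V − V/log V` versus at `V`. [folklore] -/
theorem exponent_shift_le {V b W : ℝ} (hb : 1 ≤ b) (hV : 2 * b ^ 2 ≤ V) (hV36 : 36 ≤ V) (hL : 2 ≤ Real.log V)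
    (hWV' : W = V - V / Real.log V) :
    -W * Real.log (W / b) + 2 * W * Real.log (Real.log W) + 8 * W ≤
      -V * Real.log (V / b) + 2 * V * Real.log (Real.log V) + 10 * V := by
  have hV0 : 0 < V := by linarith
  have hb0 : 0 < b := by linarith
  have hL0 : 0 < Real.log V := by linarith
  set y : ℝ := 1 / Real.log V with hy
  have hy0 : 0 < y := by positivity
  have hy1 : y ≤ 1 / 2 := by
    rw [hy, div_le_div_iff₀ hL0 (by norm_num)]; linarith
  have hWdef : W = V * (1 - y) := by rw [hWV', hy]; ring
  have hWV : W ≤ V := by rw [hWdef]; nlinarith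
  have hW2 : V / 2 ≤ W := by rw [hWdef]; nlinarith
  have hW0 : 0 < W := by linarith
  -- `2W log log W ≤ 2V log log V`
  have hW36 : (18 : ℝ) ≤ W := by linarith
  have hlogW : 1 < Real.log W := by
    have h1 : Real.log (Real.exp 1) < Real.log W := Real.log_lt_log (Real.exp_pos 1) (by
      have := Real.exp_one_lt_d9; linarith)
    rwa [Real.log_exp] at h1
  have hLLW0 : 0 ≤ Real.log (Real.log W) := Real.log_nonneg hlogW.le
  have hLLWV : Real.log (Real.log W) ≤ Real.log (Real.log V) :=
    Real.log_le_log (by linarith) (Real.log_le_log hW0 hWV)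
  have h2 : 2 * W * Real.log (Real.log W) ≤ 2 * V * Real.log (Real.log V) := by
    calc 2 * W * Real.log (Real.log W) ≤ 2 * V * Real.log (Real.log W) := by gcongr
      _ ≤ 2 * V * Real.log (Real.log V) := by gcongr
  -- `−W log(W/b) ≤ −V log(V/b) + 2V`
  have hlogVb0 : 0 ≤ Real.log (V / b) := Real.log_nonneg (by rw [le_div_iff₀ hb0]; nlinarith)
  have hlogVb : Real.log (V / b) ≤ Real.log V := by
    rw [Real.log_div hV0.ne' hb0.ne']; linarith [Real.log_nonneg hb]
  have hsplit : Real.log (W / b) = Real.log (V / b) + Real.log (1 - y) := by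
    rw [hWdef, show V * (1 - y) / b = V / b * (1 - y) by ring, Real.log_mul (by positivity) (by linarith)]
  have hlog1y : -(2 * y) ≤ Real.log (1 - y) := by
    have hpos : 0 < 1 - y := by linarith
    have h := Real.one_sub_inv_le_log_of_pos hpos
    have hinv : (1 - y)⁻¹ ≤ 1 + 2 * y := by
      rw [inv_eq_one_div, div_le_iff₀ hpos]; nlinarith
    linarith
  have h1 : -W * Real.log (W / b) ≤ -V * Real.log (V / b) + 2 * V := by
    rw [hsplit]
    have e : -W * (Real.log (V / b) + Real.log (1 - y)) =
        -V * Real.log (V / b) + (V * y) * Real.log (V / b) + (-W) * Real.log (1 - y) := by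
      rw [hWdef]; ring
    rw [e]
    have ha : V * y * Real.log (V / b) ≤ V := by
      calc V * y * Real.log (V / b) ≤ V * y * Real.log V := by gcongr
        _ = V := by rw [hy]; field_simp
    have hb' : -W * Real.log (1 - y) ≤ V := by
      have : -W * Real.log (1 - y) ≤ W * (2 * y) := by nlinarith [hlog1y, hW0]
      have h3 : W * (2 * y) ≤ V * 1 := by
        refine mul_le_mul hWV (by linarith) (by positivity) hV0.le
      linarith
    linarith
  have h3 : 8 * W ≤ 8 * V := by linarith
  linarith

end AtypicalCount

open AtypicalCount in
/-- **Balazard–de Roton 2008, Prop. 20, under RH** (the number of well-spaced `V`-atypical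
ordinates), with `O(V) = 12V`: for `0 < δ ≤ 1` there is `T₀ = T₀(δ)` such that for `T ≥ T₀`,
`2 (log log T)² ≤ V ≤ log T/log log T`, and every finite `1`-spaced set `𝒯 ⊂ [T, 2T]` of
ordinates none of which is `V`-typical of size `T` (`IsVTypical δ T V`),
`#𝒯 ≤ T exp(−V log(V/log log T) + 2V log log V + 12V)`. [cite: BalazardDeRoton2008, Prop. 20] -/
theorem card_atypical_le_of_RH (hRH : RiemannHypothesis) {δ : ℝ} (hδ0 : 0 < δ) (hδ1 : δ ≤ 1) :
    ∃ T₀ : ℝ, ∀ T : ℝ, T₀ ≤ T → ∀ V : ℝ,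
      2 * Real.log (Real.log T) ^ 2 ≤ V → V ≤ Real.log T / Real.log (Real.log T) →
      ∀ 𝒯 : Finset ℝ, (∀ t ∈ 𝒯, T ≤ t ∧ t ≤ 2 * T) →
      (∀ t ∈ 𝒯, ∀ t' ∈ 𝒯, t ≠ t' → 1 ≤ |t - t'|) →
      (∀ t ∈ 𝒯, ¬ IsVTypical δ T V t) →
      (𝒯.card : ℝ) ≤ T * Real.exp (-V * Real.log (V / Real.log (Real.log T)) +
        2 * V * Real.log (Real.log V) + 12 * V) := by
  classical
  obtain ⟨T₁, hT₁⟩ := card_fail_primeSum_le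
  obtain ⟨T₂, hT₂⟩ := card_fail_window_le_of_RH hRH
  obtain ⟨a₀, ha₀⟩ := Filter.eventually_atTop.1 eventually_conditions_i
  refine ⟨max T₁ (max T₂ (Real.exp a₀)), fun T hT V hVl hVu 𝒯 h𝒯 hsep hat ↦ ?_⟩
  have hTT₁ : T₁ ≤ T := (le_max_left _ _).trans hT
  have hTT₂ : T₂ ≤ T := ((le_max_left _ _).trans (le_max_right _ _)).trans hT
  have hTa₀ : Real.exp a₀ ≤ T := ((le_max_right _ _).trans (le_max_right _ _)).trans hT
  have hT0 : 0 < T := (Real.exp_pos a₀).trans_le hTa₀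
  set a : ℝ := Real.log T with ha
  have haa₀ : a₀ ≤ a := by rw [ha, ← Real.log_exp a₀]; exact Real.log_le_log (Real.exp_pos _) hTa₀
  obtain ⟨ha4, hb6⟩ := ha₀ a haa₀
  set b : ℝ := Real.log a with hb
  have hb0 : 0 < b := by linarith only [hb6]
  have ha0 : 0 < a := by linarith only [ha4]
  have hTa : Real.exp a = T := by rw [ha, Real.exp_log hT0]
  have haT : a + 1 ≤ T := by rw [← hTa]; exact Real.add_one_le_exp a
  have hT1 : 1 ≤ T := by linarith only [haT, ha4]
  have hπ3 := Real.pi_gt_three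
  have hπ4 := Real.pi_lt_four
  have hV72 : (72 : ℝ) ≤ V := by nlinarith only [hb6, hVl]
  have hV0 : 0 < V := by linarith only [hV72]
  have hVa : V * b ≤ a := by rwa [le_div_iff₀ hb0] at hVu
  have hVa' : V ≤ a / b := hVu
  have hbbV : b ^ 2 ≤ V := by nlinarith only [hVl, hb0]
  have hlogV2 : 2 ≤ Real.log V := by
    have he2 : Real.exp 2 ≤ 9 := by
      have := Real.exp_one_lt_d9
      have h2 : Real.exp 2 = Real.exp 1 * Real.exp 1 := by rw [← Real.exp_add]; norm_num
      rw [h2]; nlinarith [Real.exp_pos 1]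
    have : Real.log (Real.exp 2) ≤ Real.log V := Real.log_le_log (Real.exp_pos 2) (by linarith only [he2, hV72])
    rwa [Real.log_exp] at this
  have hlogV0 : 0 < Real.log V := by linarith only [hlogV2]
  -- `log((2T+2)/2π) ≤ a`
  have hlogwin : Real.log ((2 * T + 2) / (2 * π)) ≤ a := by
    rw [ha]
    refine Real.log_le_log (by positivity) ?_
    rw [div_le_iff₀ (by positivity)]; nlinarith only [hπ3, hT1]
  -- the three failure sets
  set 𝒯₁ := 𝒯.filter fun t ↦ ∃ σ : ℝ, 1 / 2 ≤ σ ∧ 2 * V < ‖typicalPrimeSum T V σ t‖ with h𝒯₁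
  set 𝒯₂ := 𝒯.filter fun t ↦ ∃ u : ℝ, t - 1 ≤ u ∧ u + 2 * π * δ * V / Real.log T ≤ t + 1 ∧
    (1 + δ) * V < ((zetaZeroCount (u + 2 * π * δ * V / Real.log T) : ℝ) - zetaZeroCount u) with h𝒯₂
  set 𝒯₃ := 𝒯.filter fun t ↦ ∃ u : ℝ, t - 1 ≤ u ∧ u + 2 * π * V / (Real.log V * Real.log T) ≤ t + 1 ∧
    V < ((zetaZeroCount (u + 2 * π * V / (Real.log V * Real.log T)) : ℝ) - zetaZeroCount u) with h𝒯₃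
  have hcover : 𝒯 ⊆ 𝒯₁ ∪ 𝒯₂ ∪ 𝒯₃ := by
    intro t ht
    by_contra hnot
    rw [Finset.mem_union, Finset.mem_union, not_or, not_or] at hnot
    obtain ⟨⟨h1, h2⟩, h3⟩ := hnot
    rw [h𝒯₁, Finset.mem_filter, not_and] at h1
    rw [h𝒯₂, Finset.mem_filter, not_and] at h2
    rw [h𝒯₃, Finset.mem_filter, not_and] at h3
    have h1 := h1 ht; have h2 := h2 ht; have h3 := h3 ht
    push Not at h1 h2 h3
    obtain ⟨htl, htu⟩ := h𝒯 t ht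
    exact hat t ht ⟨htl, htu, h1, h2, h3⟩
  have hsub : ∀ {𝒰 : Finset ℝ}, 𝒰 ⊆ 𝒯 → (∀ t ∈ 𝒰, T ≤ t ∧ t ≤ 2 * T) ∧
      (∀ t ∈ 𝒰, ∀ t' ∈ 𝒰, t ≠ t' → 1 ≤ |t - t'|) := fun h𝒰 ↦
    ⟨fun t ht ↦ h𝒯 t (h𝒰 ht), fun t ht t' ht' ↦ hsep t (h𝒰 ht) t' (h𝒰 ht')⟩
  have h1sub : 𝒯₁ ⊆ 𝒯 := by rw [h𝒯₁]; exact Finset.filter_subset _ _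
  have h2sub : 𝒯₂ ⊆ 𝒯 := by rw [h𝒯₂]; exact Finset.filter_subset _ _
  have h3sub : 𝒯₃ ⊆ 𝒯 := by rw [h𝒯₃]; exact Finset.filter_subset _ _
  -- (i)
  have hc1 : (𝒯₁.card : ℝ) ≤ T * Real.exp (-V * Real.log (V / b) + 4 * V) := by
    obtain ⟨hw, hs⟩ := hsub h1sub
    exact hT₁ T hTT₁ V hVl hVu 𝒯₁ hw hs fun t ht ↦ (Finset.mem_filter.1 ht).2
  -- (ii): `h = πδV/a`, `W = V`, `B = (1+δ)V`
  have hc2 : (𝒯₂.card : ℝ) ≤ 4 * (T * Real.exp (-V * Real.log (V / b) + 2 * V * Real.log (Real.log V) + 8 * V)) := by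
    set h : ℝ := π * δ * V / a with hh
    have hh0 : 0 < h := by positivity
    have hh1 : h ≤ 1 := by
      rw [hh, div_le_one ha0]
      calc π * δ * V ≤ π * 1 * V := by gcongr
        _ ≤ b * V := by nlinarith only [hπ4, hb6, hV0]
        _ ≤ a := by linarith only [hVa, mul_comm b V]
    have hWB : V + h / π * Real.log ((2 * T + 2) / (2 * π)) ≤ (1 + δ) * V := by
      have e : h / π = δ * V / a := by rw [hh]; field_simp
      rw [e]
      have : δ * V / a * Real.log ((2 * T + 2) / (2 * π)) ≤ δ * V / a * a :=
        mul_le_mul_of_nonneg_left hlogwin (by positivity)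
      rw [div_mul_cancel₀ _ ha0.ne'] at this
      linarith only [this]
    obtain ⟨hw, hs⟩ := hsub h2sub
    refine hT₂ T hTT₂ h hh0 hh1 V ((1 + δ) * V) hbbV hVu hWB 𝒯₂ hw hs fun t ht ↦ ?_
    obtain ⟨u, hu1, hu2, hu3⟩ := (Finset.mem_filter.1 ht).2
    have e2 : 2 * π * δ * V / Real.log T = 2 * h := by rw [hh, ← ha]; ring
    rw [e2] at hu2 hu3
    exact ⟨u, hu1, hu2, hu3⟩
  -- (iii): `h = πV/(log V · a)`, `W = V − V/log V`, `B = V`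
  set W : ℝ := V - V / Real.log V with hW
  have hc3 : (𝒯₃.card : ℝ) ≤ 4 * (T * Real.exp (-W * Real.log (W / b) + 2 * W * Real.log (Real.log W) + 8 * W)) := by
    set h : ℝ := π * V / (Real.log V * a) with hh
    have hh0 : 0 < h := by positivity
    have hh1 : h ≤ 1 := by
      rw [hh, div_le_one (by positivity)]
      calc π * V ≤ 4 * V := by nlinarith only [hπ4, hV0]
        _ ≤ 2 * (b * V) := by nlinarith only [hb6, hV0]
        _ ≤ Real.log V * a := by
            have : b * V ≤ a := by linarith only [hVa, mul_comm b V]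
            nlinarith only [this, hlogV2, ha0]
    have hWB : W + h / π * Real.log ((2 * T + 2) / (2 * π)) ≤ V := by
      have e : h / π = V / (Real.log V * a) := by rw [hh]; field_simp
      rw [e]
      have : V / (Real.log V * a) * Real.log ((2 * T + 2) / (2 * π)) ≤ V / (Real.log V * a) * a :=
        mul_le_mul_of_nonneg_left hlogwin (by positivity)
      have e2 : V / (Real.log V * a) * a = V / Real.log V := by field_simp
      rw [e2] at this
      rw [hW]; linarith only [this]
    have hWl : b ^ 2 ≤ W := by
      have : V / Real.log V ≤ V / 2 := div_le_div_of_nonneg_left hV0.le (by norm_num) hlogV2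
      rw [hW]; nlinarith only [this, hVl]
    have hWu : W ≤ a / b := by
      have : 0 ≤ V / Real.log V := by positivity
      rw [hW]; linarith only [this, hVa']
    obtain ⟨hw, hs⟩ := hsub h3sub
    refine hT₂ T hTT₂ h hh0 hh1 W V hWl hWu hWB 𝒯₃ hw hs fun t ht ↦ ?_
    obtain ⟨u, hu1, hu2, hu3⟩ := (Finset.mem_filter.1 ht).2
    have e2 : 2 * π * V / (Real.log V * Real.log T) = 2 * h := by rw [hh, ← ha]; ring
    rw [e2] at hu2 hu3
    exact ⟨u, hu1, hu2, hu3⟩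
  have hexp3 := exponent_shift_le (by linarith only [hb6] : (1 : ℝ) ≤ b) hVl (by linarith only [hV72]) hlogV2 hW
  -- combine
  have hcard : (𝒯.card : ℝ) ≤ 𝒯₁.card + 𝒯₂.card + 𝒯₃.card := by
    have h1 := Finset.card_le_card hcover
    have h2 := (Finset.card_union_le (𝒯₁ ∪ 𝒯₂) 𝒯₃)
    have h3 := Finset.card_union_le 𝒯₁ 𝒯₂
    exact_mod_cast h1.trans (h2.trans (by omega))
  set E : ℝ := -V * Real.log (V / b) + 2 * V * Real.log (Real.log V) + 10 * V with hE
  have hLLV0 : 0 ≤ Real.log (Real.log V) := Real.log_nonneg (by linarith only [hlogV2])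
  have hE1 : Real.exp (-V * Real.log (V / b) + 4 * V) ≤ Real.exp E := Real.exp_le_exp.2 (by
    rw [hE]; nlinarith only [hLLV0, hV0])
  have hE2 : Real.exp (-V * Real.log (V / b) + 2 * V * Real.log (Real.log V) + 8 * V) ≤ Real.exp E :=
    Real.exp_le_exp.2 (by rw [hE]; linarith only [hV0])
  have hE3 : Real.exp (-W * Real.log (W / b) + 2 * W * Real.log (Real.log W) + 8 * W) ≤ Real.exp E :=
    Real.exp_le_exp.2 (by rw [hE]; exact hexp3)
  have h9 : (9 : ℝ) * Real.exp E ≤ Real.exp (E + 2 * V) := by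
    have h2V : (9 : ℝ) ≤ Real.exp (2 * V) := by
      have := Real.add_one_le_exp (2 * V); linarith only [this, hV72]
    calc (9 : ℝ) * Real.exp E ≤ Real.exp (2 * V) * Real.exp E :=
          mul_le_mul_of_nonneg_right h2V (Real.exp_pos E).le
      _ = Real.exp (E + 2 * V) := by rw [mul_comm, ← Real.exp_add]
  have hfinalE : E + 2 * V = -V * Real.log (V / b) + 2 * V * Real.log (Real.log V) + 12 * V := by
    rw [hE]; ring
  rw [← hfinalE]
  have hTpos : 0 ≤ T := hT0.le
  calc (𝒯.card : ℝ) ≤ 𝒯₁.card + 𝒯₂.card + 𝒯₃.card := hcard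
    _ ≤ T * Real.exp E + 4 * (T * Real.exp E) + 4 * (T * Real.exp E) := by
        gcongr
        · exact hc1.trans (by gcongr)
        · exact hc2.trans (by gcongr)
        · exact hc3.trans (by gcongr)
    _ = T * (9 * Real.exp E) := by ring
    _ ≤ T * Real.exp (E + 2 * V) := by gcongr

end Literature.NumberTheory.LFunctions
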